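import Literature.NumberTheory.EllipticCurves.LevelLoweringGamma0AtThreePrimeThree
import HarnessLib

/-!
# Level lowering at any ONE split multiplicative prime `q` (the case `q = 3` included), `p = 3` — glue

Topic `NumberTheory/EllipticCurves`; namespace `Literature.NumberTheory.EllipticCurves`. Theorem-only file
(no definitions, no named facts): the statement of the tree's named fact
`ribet1990_levelLowering_gamma0_newform_at_three` (sibling `LevelLoweringGamma0AtThree`, one split
multiplicative prime `q ≠ 3`) with its binder `q ≠ 3` DELETED, PROVED from that fact together with its `q = 3`
twin `ribet1990_levelLowering_gamma0_newform_at_three_prime_three` (sibling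
`LevelLoweringGamma0AtThreePrimeThree`; Mazur's principle / Diamond 1995 Thm. 6.4, finite-at-`3` case) by
cases on `q = 3`: at `q = 3` the sibling's hypothesis `3 ∣ ord_q(Δ)` IS the twin's finiteness hypothesis,
its side condition (F1) implies the twin's because `3 ∤ M`, and (F2) is not needed. This is the `q`-uniform
shape instantiated by the `bsd-addord` consumer (`stmt-BirchSwinnertonDyer-19679`, stub `stub_nonAdditive`,
road (b): `…stub_nonAdditive_semistable_of_vatsal_of_levelLoweredNewform` takes a prime `q` of split
multiplicative reduction with no `q ≠ 3` binder; work items `wi-76329`, `wi-76751`).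

## References

* F. Diamond, *The refined conjecture of Serre*, in: Elliptic Curves, Modular Forms & Fermat's Last Theorem
  (Hong Kong 1993), International Press (1995) 22–37, Thm. 6.4, Cor. 6.5. [Diamond1995RefinedSerre]
* K. A. Ribet, *On modular representations of Gal(ℚ̄/ℚ) arising from modular forms*, Invent. Math. 100
  (1990) 431–476, Thm. 1.1. [Ribet1990]
-/

noncomputable section

open scoped MatrixGroups ModularForm

open CongruenceSubgroup WeierstrassCurve Literature.NumberTheory.EllipticCurves.ModularForms

namespace Literature.NumberTheory.EllipticCurves

/-- **The two facts glued: level lowering at ANY one split multiplicative prime `q` (including `q = 3`),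
`p = 3`, semistable case** — verbatim the statement of `ribet1990_levelLowering_gamma0_newform_at_three`
with its binder `q ≠ 3` deleted (PROVED from the two named facts by cases on `q = 3`; at `q = 3` the
sibling's hypothesis `3 ∣ ord_q(Δ)` IS the finiteness hypothesis of the twin, its (F1) implies the twin's
(F1) because `3 ∤ M`, and its (F2) is not needed). This is the `q`-uniform shape instantiated by the
consumer's `stub_nonAdditive_semistable_of_vatsal_of_levelLoweredNewform`.
[cite: Diamond1995RefinedSerre, Thm. 6.4 and Cor. 6.5] [cite: Ribet1990, Thm. 1.1] -/
theorem levelLowering_gamma0_newform_at_three_all_primes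
    (h : ribet1990_levelLowering_gamma0_newform_at_three)
    (h₃ : ribet1990_levelLowering_gamma0_newform_at_three_prime_three)
    (W₀ : WeierstrassCurve ℚ) [W₀.IsElliptic] [W₀.IsGloballyMinimal]
    (hsurj : W₀.HasSurjectiveModNGaloisRep 3)
    {M q : ℕ} [NeZero M] [Fact q.Prime] (hqM : ¬ q ∣ M) (hM : Squarefree M)
    (hN : M * q = W₀.conductorNorm ℤ)
    (hsplit : W₀.HasSplitMultiplicativeReductionAtPrime q)
    (hq : (3 : ℤ) ∣ padicValRat q W₀.Δ)
    (hram : ∀ ℓ : ℕ, ℓ.Prime → ℓ ∣ M → ℓ ≠ 3 → ¬ (3 : ℤ) ∣ padicValRat ℓ W₀.Δ)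
    (h3 : 3 ∣ M → ¬ (3 : ℤ) ∣ padicValRat 3 W₀.Δ)
    (D₀ : ModularParametrizationData W₀ (M * q)) (ι : PadicAlgCl 3 ≃+* ℂ) :
    ∃ g : CuspForm (Gamma0 M) 2, IsNewform0 g ∧
      (∀ ℓ : ℕ, ℓ.Prime → ℓ ≠ q → Valued.v (ι.symm (cuspCoeff D₀.f ℓ - cuspCoeff g ℓ)) < 1) ∧
      Valued.v (ι.symm (cuspCoeff g q - (q + 1))) < 1 := by
  by_cases hq3 : q = 3
  · subst hq3
    have hram' : ∀ ℓ : ℕ, ℓ.Prime → ℓ ∣ M → ¬ (3 : ℤ) ∣ padicValRat ℓ W₀.Δ :=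
      fun ℓ hℓ hℓM => hram ℓ hℓ hℓM (by rintro rfl; exact hqM hℓM)
    simpa using h₃ W₀ hsurj hqM hM hN hsplit hq hram' D₀ ι
  · exact h W₀ hsurj hq3 hqM hM hN hsplit hq hram h3 D₀ ι

end Literature.NumberTheory.EllipticCurves

end
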